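import Mathlib
import Summits.ValiantsHypothesis.ValiantsHypothesis.Theorems.DivisionGapShadowBirkhoffCounterDefs

/-!
# Stub `stub_growth` of the line `Sketch-ideator4` for the crux `DivisionGap.ShadowBirkhoff`
(stmt-ValiantsHypothesis-5069): the growth arithmetic

Registered stub of the crux skeleton `Cruxes/ShadowBirkhoff/Lines/Sketch-ideator4.lean`
(line lead prover-line-stmt-ValiantsHypothesis-5069-a3-0).  Pure arithmetic: if for some `k` and every `K`
there is a weighted pattern of quasi-polynomial size `N ≤ 2^((log₂ K + k)^k)` whose value set has at least
`2^K` lower vertices, then for every `c` and all large `n` there is a pattern of size `N ≤ n` with more than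
`2^((log₂ n + c)^c)` lower vertices.  The set `lowerVertices (valueSet G wb wa)` (objects of
`Theorems/DivisionGapShadowBirkhoffCounterDefs.lean`) is a black box here.

Proof: for `n` put `L := log₂ n` and `K := (L + c)^c + 1`; then `2^((L+c)^c) < 2^K ≤ #lowerVertices`, and the
size is `N ≤ 2^((log₂ K + k)^k) ≤ 2^L ≤ n` as soon as `(log₂ K + k)^k ≤ L`, which holds for all large `L`
because `log₂ K ≤ c (log₂ L + 2) + 1` is logarithmic in `L` and polynomials in `log₂ L` are eventually
`≤ 2^(log₂ L) ≤ L` (`growth_pow_le_two_pow`, from Mathlib's `tendsto_pow_const_div_const_pow_of_one_lt`).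
-/

set_option linter.dupNamespace false

noncomputable section

open scoped BigOperators

namespace Summit.ValiantsHypothesis.ValiantsHypothesis.Theorems.DivisionGapShadowBirkhoff

/-- Polynomial versus exponential growth: `(d·j + d)^e ≤ 2^j` for all large `j`. [folklore] -/
theorem growth_pow_le_two_pow (d e : ℕ) : ∃ j₀ : ℕ, ∀ j ≥ j₀, (d * j + d) ^ e ≤ 2 ^ j := by
  -- adapted from `eventually_mul_pow_lt_two_pow`
  -- (Literature/Computability/MetaComplexity/SmolenskyNaturalProperty.lean)
  have ht := tendsto_pow_const_div_const_pow_of_one_lt e (one_lt_two (α := ℝ))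
  have hM : (0 : ℝ) < (2 * d : ℝ) ^ e + 1 := by positivity
  have hev : ∀ᶠ j : ℕ in Filter.atTop, (j : ℝ) ^ e / 2 ^ j < 1 / ((2 * d : ℝ) ^ e + 1) :=
    ht.eventually (gt_mem_nhds (by positivity))
  obtain ⟨j₁, hj₁⟩ := Filter.eventually_atTop.1 hev
  refine ⟨max j₁ 1, fun j hj => ?_⟩
  have hj1 : 1 ≤ j := le_of_max_le_right hj
  have h := hj₁ j (le_of_max_le_left hj)
  have h2pos : (0 : ℝ) < 2 ^ j := by positivity
  rw [div_lt_iff₀ h2pos, one_div, inv_mul_eq_div, lt_div_iff₀ hM] at h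
  have hnat : j ^ e * ((2 * d) ^ e + 1) < 2 ^ j := by exact_mod_cast h
  have hdj : d * j + d ≤ 2 * d * j := by nlinarith
  calc (d * j + d) ^ e ≤ (2 * d * j) ^ e := Nat.pow_le_pow_left hdj e
    _ = j ^ e * (2 * d) ^ e := by ring
    _ ≤ j ^ e * ((2 * d) ^ e + 1) := Nat.mul_le_mul_left _ (Nat.le_succ _)
    _ ≤ 2 ^ j := hnat.le

/-- A crude logarithmic bound: `log₂ ((L + c)^c + 1) ≤ c (log₂ L + 2) + 1` for `c ≤ L`. [folklore] -/
theorem growth_log_bound {c L : ℕ} (hcL : c ≤ L) :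
    Nat.log 2 ((L + c) ^ c + 1) ≤ c * (Nat.log 2 L + 2) + 1 := by
  set j := Nat.log 2 L with hj
  have hL : L < 2 ^ (j + 1) := Nat.lt_pow_succ_log_self one_lt_two L
  have hLc : L + c ≤ 2 ^ (j + 2) := by
    calc L + c ≤ 2 ^ (j + 1) + 2 ^ (j + 1) := by omega
      _ = 2 ^ (j + 2) := by ring
  have hpow : (L + c) ^ c ≤ 2 ^ (c * (j + 2)) := by
    calc (L + c) ^ c ≤ (2 ^ (j + 2)) ^ c := Nat.pow_le_pow_left hLc c
      _ = 2 ^ (c * (j + 2)) := (pow_mul' 2 c (j + 2)).symm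
  have hle : (L + c) ^ c + 1 ≤ 2 ^ (c * (j + 2) + 1) := by
    have h1 : 1 ≤ 2 ^ (c * (j + 2)) := Nat.one_le_two_pow
    calc (L + c) ^ c + 1 ≤ 2 ^ (c * (j + 2)) + 2 ^ (c * (j + 2)) := by omega
      _ = 2 ^ (c * (j + 2) + 1) := by ring
  calc Nat.log 2 ((L + c) ^ c + 1) ≤ Nat.log 2 (2 ^ (c * (j + 2) + 1)) := Nat.log_mono_right hle
    _ = c * (j + 2) + 1 := Nat.log_pow one_lt_two _

/-- The key growth estimate: `(log₂ ((L + c)^c + 1) + k)^k ≤ L` for all large `L` (the exponent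
`(log₂ K + k)^k` of the quasi-polynomial size bound at `K = (L + c)^c + 1` is polylogarithmic in `L`).
[folklore] -/
theorem growth_key (c k : ℕ) :
    ∃ L₀ : ℕ, ∀ L ≥ L₀, (Nat.log 2 ((L + c) ^ c + 1) + k) ^ k ≤ L := by
  obtain ⟨j₀, hj₀⟩ := growth_pow_le_two_pow (2 * c + k + 1) k
  refine ⟨max c (2 ^ j₀), fun L hL => ?_⟩
  have hcL : c ≤ L := le_of_max_le_left hL
  have hL2 : 2 ^ j₀ ≤ L := le_of_max_le_right hL
  have hL0 : L ≠ 0 := (lt_of_lt_of_le (Nat.two_pow_pos j₀) hL2).ne'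
  set j := Nat.log 2 L with hj
  have hjj : j₀ ≤ j := Nat.le_log_of_pow_le one_lt_two hL2
  have hlog : Nat.log 2 ((L + c) ^ c + 1) ≤ c * (j + 2) + 1 := growth_log_bound hcL
  have hcj : c * j ≤ (2 * c + k + 1) * j := Nat.mul_le_mul_right j (by omega)
  have h1 : Nat.log 2 ((L + c) ^ c + 1) + k ≤ (2 * c + k + 1) * j + (2 * c + k + 1) := by
    rw [Nat.mul_add] at hlog
    omega
  calc (Nat.log 2 ((L + c) ^ c + 1) + k) ^ k
        ≤ ((2 * c + k + 1) * j + (2 * c + k + 1)) ^ k := Nat.pow_le_pow_left h1 k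
    _ ≤ 2 ^ j := hj₀ j hjj
    _ ≤ L := Nat.pow_log_le_self 2 hL0

/-- **STUB 4 · `stub_growth`** — growth arithmetic (registered signature): patterns of quasi-polynomial size
`N ≤ 2^((log₂ K + k)^k)` with `2^K` lower vertices give, for every `c` and all large `n`, a pattern of size
`≤ n` with more than `2^((log₂ n + c)^c)` lower vertices (take `K = (log₂ n + c)^c + 1`; then
`2^((log₂ K + k)^k) ≤ n` for large `n` because `(log₂ K + k)^k` is polylogarithmic in `log₂ n`). -/
theorem stub_growth
    (h : ∃ k : ℕ, ∀ K : ℕ, ∃ N : ℕ, N ≤ 2 ^ ((Nat.log 2 K + k) ^ k) ∧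
      ∃ (G : Finset (Fin N × Fin N)) (wb wa : Fin N → Fin N → ℝ),
        2 ^ K ≤ (lowerVertices (valueSet G wb wa)).ncard) :
    ∀ c : ℕ, ∃ n₀ : ℕ, ∀ n ≥ n₀, ∃ N ≤ n,
      ∃ (G : Finset (Fin N × Fin N)) (wb wa : Fin N → Fin N → ℝ),
        2 ^ ((Nat.log 2 n + c) ^ c) < (lowerVertices (valueSet G wb wa)).ncard := by
  obtain ⟨k, hk⟩ := h
  intro c
  obtain ⟨L₀, hL₀⟩ := growth_key c k
  refine ⟨2 ^ L₀, fun n hn => ?_⟩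
  have hn0 : n ≠ 0 := (lt_of_lt_of_le (Nat.two_pow_pos L₀) hn).ne'
  have hL : L₀ ≤ Nat.log 2 n := Nat.le_log_of_pow_le one_lt_two hn
  obtain ⟨N, hN, G, wb, wa, hcount⟩ := hk ((Nat.log 2 n + c) ^ c + 1)
  refine ⟨N, ?_, G, wb, wa, ?_⟩
  · calc N ≤ 2 ^ ((Nat.log 2 ((Nat.log 2 n + c) ^ c + 1) + k) ^ k) := hN
      _ ≤ 2 ^ Nat.log 2 n := Nat.pow_le_pow_right two_pos (hL₀ _ hL)
      _ ≤ n := Nat.pow_log_le_self 2 hn0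
  · calc 2 ^ ((Nat.log 2 n + c) ^ c)
          < 2 ^ ((Nat.log 2 n + c) ^ c + 1) := Nat.pow_lt_pow_right one_lt_two (Nat.lt_succ_self _)
      _ ≤ (lowerVertices (valueSet G wb wa)).ncard := hcount

end Summit.ValiantsHypothesis.ValiantsHypothesis.Theorems.DivisionGapShadowBirkhoff

end
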